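import Summits.AtomisticToContinuum.Crystallization.Theorems.ThreeConeCertificateDefs
import Literature.MathematicalPhysics.StatisticalMechanics.LennardJonesClusters

/-!
# `OnePercentCertificate` (stmt-AtomisticToContinuum-11958) — line `perron-gauge`: certificate checkers

Helper lemmas of the line `perron-gauge-Sketch` (skeleton `Cruxes/OnePercentCertificate/Lines/perron_gauge_Sketch.lean`,
lead prover-line-stmt-AtomisticToContinuum-11958-a1-0).  The line's registered stub `stub_weightedStability` is the
operator inequality (C⁺) `Σ_{i≠j} v_i v_j att(r_ij) ≤ Σ_i (2c + Σ_{j≠i} rep(r_ij)) v_i²` for all weights `v` on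
hard-core-separated configurations, `att = max (−g) 0`, `rep = max g 0` (i.e. `λ_max(Φ(x) − diag D(x)) ≤ 2c`).
This file contains the elementary CHECKERS by which a certificate of C⁺ is verified in Lean, and the passage
from C⁺ to `c`-stability:

* `schur_test` — weighted Schur test / positive gauge (the easy direction of Collatz–Wielandt): for a symmetric
  kernel `a ≥ 0` and any positive `p`, `Σ_{i≠j} v_i v_j a_ij ≤ Σ_i (Σ_{j≠i} a_ij p_j/p_i) v_i²` (termwise AM–GM);
* `weightedStability_of_gauge` — a positive gauge with gauged binding `Σ_{j≠i}(att_ij p_j/p_i − rep_ij) ≤ 2c`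
  at every site certifies C⁺ for that configuration;
* `stable_of_weightedStability` — C⁺ with `v ≡ 1` is `−c·N ≤ E_g(x)`.

Everything is stated for a general pair potential `g : ℝ → ℝ` and constant `c`, with all Props inlined (no
definitions). [folklore]
-/

noncomputable section

open scoped BigOperators
open Literature.MathematicalPhysics.StatisticalMechanics

namespace Summit.AtomisticToContinuum.Crystallization.Theorems.PerronGauge

/-! ## Checkers: how a certificate of C⁺ is verified (weighted Schur test / positive gauge) -/

section Checkers

variable {N : ℕ}

/-- Swapping the order of summation over ordered pairs `i ≠ j`. [folklore] -/
theorem sum_erase_comm (F : Fin N → Fin N → ℝ) :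
    ∑ i, ∑ j ∈ Finset.univ.erase i, F i j = ∑ j, ∑ i ∈ Finset.univ.erase j, F i j := by
  refine Finset.sum_comm' ?_
  intro i j
  simp only [Finset.mem_univ, Finset.mem_erase, true_and, and_true, ne_comm]

/-- **Weighted Schur test (positive gauge).** For a symmetric kernel `a ≥ 0` on ordered pairs and any
positive gauge `p`, `Σ_{i≠j} v_i v_j a_ij ≤ Σ_i (Σ_{j≠i} a_ij p_j/p_i) v_i²` (AM–GM:
`2 v_i v_j ≤ (p_j/p_i) v_i² + (p_i/p_j) v_j²`).  This is the easy direction of Collatz–Wielandt: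
a positive `p` with `(A p)_i ≤ μ p_i` certifies `λ_max(A) ≤ μ`. [folklore] -/
theorem schur_test (a : Fin N → Fin N → ℝ) (hsymm : ∀ i j, a i j = a j i) (hnn : ∀ i j, 0 ≤ a i j)
    (p : Fin N → ℝ) (hp : ∀ i, 0 < p i) (v : Fin N → ℝ) :
    ∑ i, ∑ j ∈ Finset.univ.erase i, v i * v j * a i j
      ≤ ∑ i, (∑ j ∈ Finset.univ.erase i, a i j * (p j / p i)) * v i ^ 2 := by
  -- termwise AM–GM
  have hterm : ∀ i j, v i * v j * a i j
      ≤ (a i j * (p j / p i) * v i ^ 2 + a j i * (p i / p j) * v j ^ 2) / 2 := by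
    intro i j
    have hpi := hp i
    have hpj := hp j
    rw [hsymm j i]
    have key : 2 * (v i * v j) ≤ p j / p i * v i ^ 2 + p i / p j * v j ^ 2 := by
      have h1 : p j / p i * v i ^ 2 + p i / p j * v j ^ 2 - 2 * (v i * v j)
          = (p j * v i - p i * v j) ^ 2 / (p i * p j) := by
        field_simp
        ring
      have h2 : 0 ≤ (p j * v i - p i * v j) ^ 2 / (p i * p j) := by positivity
      linarith
    nlinarith [hnn i j, key]
  calc ∑ i, ∑ j ∈ Finset.univ.erase i, v i * v j * a i j
      ≤ ∑ i, ∑ j ∈ Finset.univ.erase i,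
          (a i j * (p j / p i) * v i ^ 2 + a j i * (p i / p j) * v j ^ 2) / 2 :=
        Finset.sum_le_sum fun i _ => Finset.sum_le_sum fun j _ => hterm i j
    _ = (∑ i, ∑ j ∈ Finset.univ.erase i, a i j * (p j / p i) * v i ^ 2) / 2
          + (∑ i, ∑ j ∈ Finset.univ.erase i, a j i * (p i / p j) * v j ^ 2) / 2 := by
        simp only [Finset.sum_div, Finset.sum_add_distrib, add_div]
    _ = (∑ i, ∑ j ∈ Finset.univ.erase i, a i j * (p j / p i) * v i ^ 2) / 2
          + (∑ j, ∑ i ∈ Finset.univ.erase j, a j i * (p i / p j) * v j ^ 2) / 2 := by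
        rw [sum_erase_comm (fun i j => a j i * (p i / p j) * v j ^ 2)]
    _ = ∑ i, (∑ j ∈ Finset.univ.erase i, a i j * (p j / p i)) * v i ^ 2 := by
        rw [← add_div, ← two_mul, mul_div_cancel_left₀ _ (two_ne_zero)]
        refine Finset.sum_congr rfl fun i _ => ?_
        rw [Finset.sum_mul]

/-- **Gauge certificate of C⁺.** If a positive gauge `p` on the particles of `x` has gauged binding
`Σ_{j≠i} (att(r_ij) p_j/p_i − rep(r_ij)) ≤ 2c` at every site, the weighted-stability inequality of
`stub_weightedStability` holds for `x` (any `g`, any `c`). [folklore] -/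
theorem weightedStability_of_gauge :
    ∀ (g : ℝ → ℝ) (c : ℝ) (N : ℕ) (x : Fin N → EuclideanSpace ℝ (Fin 3)) (p : Fin N → ℝ), (∀ i, 0 < p i) →
      (∀ i, ∑ j ∈ Finset.univ.erase i,
        (max (-g (dist (x i) (x j))) 0 * (p j / p i) - max (g (dist (x i) (x j))) 0) ≤ 2 * c) →
      ∀ v : Fin N → ℝ, ∑ i, ∑ j ∈ Finset.univ.erase i, v i * v j * max (-g (dist (x i) (x j))) 0
        ≤ ∑ i, (2 * c + ∑ j ∈ Finset.univ.erase i, max (g (dist (x i) (x j))) 0) * v i ^ 2 := by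
  intro g c N x p hp hgauge v
  have hS := schur_test (fun i j => max (-g (dist (x i) (x j))) 0)
    (fun i j => by simp only [dist_comm]) (fun i j => le_max_right _ _) p hp v
  refine hS.trans (Finset.sum_le_sum fun i _ => ?_)
  refine mul_le_mul_of_nonneg_right ?_ (sq_nonneg _)
  have := hgauge i
  rw [Finset.sum_sub_distrib] at this
  linarith

end Checkers

/-! ## From C⁺ to stability on separated configurations (`v ≡ 1`) -/

/-- C⁺ with all weights `1` is the `c`-stability of `g` on the same configurations:
`2·E_g(x) = Σ_i Σ_{j≠i} (rep − att) ≥ −2c·N`. [folklore] -/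
theorem stable_of_weightedStability :
    ∀ (g : ℝ → ℝ) (c : ℝ) (N : ℕ) (x : Fin N → EuclideanSpace ℝ (Fin 3)),
      (∀ v : Fin N → ℝ, ∑ i, ∑ j ∈ Finset.univ.erase i, v i * v j * max (-g (dist (x i) (x j))) 0
        ≤ ∑ i, (2 * c + ∑ j ∈ Finset.univ.erase i, max (g (dist (x i) (x j))) 0) * v i ^ 2) →
      -(c * (N : ℝ)) ≤ interactionEnergy g x := by
  intro g c N x h
  have h1 := h fun _ => 1
  simp only [one_mul, one_pow, mul_one, Finset.sum_add_distrib, Finset.sum_const, Finset.card_univ,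
    Fintype.card_fin, nsmul_eq_mul] at h1
  have h2 : 2 * interactionEnergy g x
      = ∑ i, ∑ j ∈ Finset.univ.erase i, max (g (dist (x i) (x j))) 0
        - ∑ i, ∑ j ∈ Finset.univ.erase i, max (-g (dist (x i) (x j))) 0 := by
    rw [two_mul_interactionEnergy, ← Finset.sum_sub_distrib]
    refine Finset.sum_congr rfl fun i _ => ?_
    rw [← Finset.sum_sub_distrib]
    exact Finset.sum_congr rfl fun j _ => (max_zero_sub_max_neg_zero_eq_self _).symm
  linarith


end Summit.AtomisticToContinuum.Crystallization.Theorems.PerronGauge
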